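import Summits.QuantumFields.BalabanUV.T4Continuum.Spine.NE1p.DressedSuppliedWitness
import Summits.QuantumFields.BalabanUV.T4Continuum.Spine.NE1p.DressedTowerWitnessBlocks

/-!
# T⁴ programme, spine estimate NE1′ (node O3b/H2) — THE ABSORBED COUNT AT DEPTH TWO, PART 1 (the datum): for EVERY blocking integer `Lb`
# an ℝ-step datum whose head absorbs BOTH older layers — `Lb⁴` blocks one scale down AND `(Lb·Lb)⁴ = (Lb⁴)²` sub-blocks two scales down
# (crew row W77 ∕ DAG N29zzzzh of `t4/formal/NE1p/LEAVES.md`, BOOKED typer gen 8 R-T140 l.23158; INTENT HOME/CLAIMS.log l.22794, STAGED l.23086).  PART 2 (`…DepthTwoWitnessEnd`): END-B at the cell's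
# integer `(Lb:ℝ) = L = 21` and the GENUINE records (S5e's count ATTAINED at depths 1 AND 2, the second layer charged, layer ratio = `Λρ₁τ`).

Cell `pub-balaban`, sub-cell `t4`, BINDER-OWNERS row NE1′, crew `b2b-balaban-t4-ne1p-formalise-*`, seat `leaf-02` (gen 16; lineage S3i ∕ S5e ∕
W8 ∕ W37 ∕ W42 ∕ W49).  ADDITIVE — imports W8 `Spine/NE1p/DressedSuppliedWitness` (p214971: the cell's numbers at `L = 21` `rW = 21⁻²·e³` ∕
`tW = 21⁻³` ∕ `stepProd_rW` BY NAME; through it rows S3 ∕ S3i ∕ S5b ∕ S5e and the root) and W14 PART 1 `Spine/NE1p/DressedTowerWitnessBlocks`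
(p216469: the block arithmetic `Blk`∕`coords`∕`coords_injective`∕`coarsen_coords_zero` BY NAME — nothing of W14's datum) ONLY; toy DATA `def`s +
theorems; nothing of S3 ∕ S3i ∕ S5 ∕ S5b ∕ S5e ∕ W8 ∕ W14 ∕ W42 restated; 0 `def … : Prop`, 0 cite, 0 sorry.

WHY.  Row S5e's `count_absorbs_of_anchoring` (`card (R.absorbs b ∩ scale j₀) ≤ (v·mB)·((Lb:ℝ)^d)^(j_b − j₀)`) feeds row S5 §3 `hbirth_of_rstep`,
whose majorant sums that count over EVERY older scale `j₀` against the geometric factor `(1 − ρ′)⁻¹`.  Every landed (γ)-datum of the crew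
absorbs at DEPTH EXACTLY ONE (W8 `w8Sabs`; W37 `absorbsR b = {b−1}`; W42 `absorbsQ`: sixteen blocks one scale down, then the previous chain
member; W18-pair `SabsP`; W32 ∕ W49 `absorbs := ∅`): the exponent `j_b − j₀ ≥ 2` and the second term of the fan-out sum had no decider.
THE DATUM `BkD Lb K` [decided toy] at cutoff `K`: births `Blk (Lb·Lb) ⊕ Blk Lb ⊕ Unit` — SUB-BLOCK families born at scale `0` (positions
`Fin 4 → Fin (Lb·Lb)` of the scale-0 blocks inside ONE scale-2 block), BLOCK families born at scale `min 1 K`, ONE head born at scale `min 2 K`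
(W8's `min` device; from `K ≥ 2` on the layers sit at `0 < 1 < 2`); cubes `Blk (Lb·Lb) ⊕ Blk Lb ⊕ Fin (K+1)`: every sub-block ∕ block at its
scale (a block cube feels its family and, once `K ≥ 1`, the `Lb⁴` sub-blocks beneath it — `parent x i = x i ∕ Lb`) and one ORIGIN cube per scale
`i ≤ K` feeling exactly the families born `≤ i` whose block key coarsens to `0` in `i − j_b` steps (the anchoring condition AS the datum; PART 2:
from scale `2` on this is EVERY family); sizes ∕ trajectory ∕ ℝ-step in W8's EQUALITY format (rate `ρ = 21⁻²·e³`, decay `τ = 21⁻³`, weight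
`AD = 1∕504`): **`absorbs head` = every strictly older family felt at the head's origin cube** (from `K ≥ 2` on: ALL `Lb⁴ + (Lb·Lb)⁴`), `∅`
else; head generation `τ^(K − min 2 K) + AD·massD`, `massD` = the absorbed pre-ℝ mass over BOTH layers BY DEFINITION; anchoring `AncD Lb K :
Anchoring _ 4 Lb` on `ℕ⁴` (`felt_under` by `coarsen_one_coords : coarsen Lb 1 (coords x) = coords (parent x)` and the origin cubes' own
condition); multiplicity `mB = 3` UNIFORMLY in `K` (one family per LAYER per block; PART 2 has the sharp `mB = 1` from `K ≥ 2` on); `CompVol 1`;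
`PreBelowEnv` ∕ `AbsorbLaw` as EQUALITIES.  Planted mutants (NOT filed; rc 1): the sub-block keyed at its parent (`keyD_inj`), `absD`
without the strict-scale cut (`absD_lt`), multiplicity `2` claimed uniformly (`hmultD`).

HONEST FRAMING (c4; offered wording).  «A DECIDED TOY at booking level — SOCKET COMPOSITION of the crew's own shapes (`Anchoring` row S4 ∕ S3i,
`RStep` row O3.E-iii-c, the seams equalities BY DEFINITION) across TWO absorbed scales, NOT that components ∕ ℝ-operations ∕ D-terms of
[Balaban1989LargeFieldII] were constructed or bounded; the function-level faces (S3u ∕ S3v) are NOT exercised (W42 ∕ W49 did, at depth one);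
nothing of Bałaban's is modelled.»  [decided toy] ∕ [folklore]; 0 `def … : Prop`; 0 citations (the bracketed paper name is the rider's wording,
no locus used).  0 binders instantiated on Bałaban's densities; no wall item; the NE1′ wall wording of record v1.8 (T4-DAG v48 deb37c21e2d251d1)
— words, not kind — does NOT move; R-t4r2-Q2 NOT met; NE1′ ⇐ the named binders — NOT proved, NOT printed; spine PROVED 0∕9; count 9 unchanged.
Rung (B)+1 on ONE finite four-torus — NOT infinite volume, NOT a mass gap, NOT OS on ℝ⁴, NOT Clay.  HONEST DEPENDENCY: continuum YM on T⁴ ⇐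
BetaPertH ∧ nine spine estimates (0/9 proved); BetaPertH ⇐ (D1) ∧ (D4) ∧ CAP+tail; G-an2-4 gates asym, D1 and NE2/3/4.
-/

noncomputable section

namespace Summit.QuantumFields.BalabanUV.T4Continuum.NE1p.DressedSuppliedDepthTwoWitness

open Finset
open scoped BigOperators
open Literature.MathematicalPhysics.QuantumFieldTheory.Balaban1983to89
open Literature.MathematicalPhysics.QuantumFieldTheory.Balaban1983to89.T4TermFormat
open Literature.MathematicalPhysics.QuantumFieldTheory.Balaban1983to89.T4TermFormat.Booking
open Literature.MathematicalPhysics.QuantumFieldTheory.Balaban1983to89.T4FeltGeometry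
open Literature.MathematicalPhysics.QuantumFieldTheory.Balaban1983to89.T4TrajectoryComparison
open Literature.MathematicalPhysics.QuantumFieldTheory.Balaban1983to89.T4PreservedUnderR (RStep)
open Summit.QuantumFields.BalabanUV.T4Continuum.T4TrajectoryDensityDressed
open Summit.QuantumFields.BalabanUV.T4Continuum.NE1p.DressedRoot
open Summit.QuantumFields.BalabanUV.T4Continuum.NE1p.DressedUniformConstants
open Summit.QuantumFields.BalabanUV.T4Continuum.NE1p.DressedAbsorptionWindow
open Summit.QuantumFields.BalabanUV.T4Continuum.NE1p.DressedPositionalCount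
open Summit.QuantumFields.BalabanUV.T4Continuum.NE1p.DressedStabilityOfSuppliedSchedules
open Summit.QuantumFields.BalabanUV.T4Continuum.NE1p.DressedBirthRStepAnchored
open Summit.QuantumFields.BalabanUV.T4Continuum.NE1p.DressedSuppliedWitness (rW tW rW_pos tW_pos hL21 hloc21 hρ'21 stepProd_rW)
open Summit.QuantumFields.BalabanUV.T4Continuum.NE1p.DressedTowerWitnessBlocks (Blk coords coords_injective coarsen_coords_zero
  coarsen_coords_succ)

/-! ## §1 The datum: sub-block and block families, both layers absorbed by ONE head; the anchoring and the ℝ-step -/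

section Toy

variable (Lb : ℕ)

/-- BIRTH INDEX [decided toy]: sub-blocks, blocks, the head. [folklore] -/
abbrev IxB : Type := Blk (Lb * Lb) ⊕ Blk Lb ⊕ Unit

/-- CUBE INDEX at cutoff `K` [decided toy]: sub-blocks, blocks, one origin cube per scale `0 … K`. [folklore] -/
abbrev IxC (K : ℕ) : Type := Blk (Lb * Lb) ⊕ Blk Lb ⊕ Fin (K + 1)

/-- The head family. [folklore] -/
abbrev headD : IxB Lb := Sum.inr (Sum.inr ())

variable {Lb}

/-- Birth scales [decided toy]: `0`, `min 1 K`, `min 2 K`. [folklore] -/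
def scB (K : ℕ) : IxB Lb → ℕ
  | Sum.inl _ => 0
  | Sum.inr (Sum.inl _) => min 1 K
  | Sum.inr (Sum.inr _) => min 2 K

/-- [folklore] Birth scales are `≤ K`. -/
theorem scB_le (K : ℕ) : ∀ b : IxB Lb, scB K b ≤ K
  | Sum.inl _ => Nat.zero_le K
  | Sum.inr (Sum.inl _) => Nat.min_le_right 1 K
  | Sum.inr (Sum.inr _) => Nat.min_le_right 2 K

/-- Cube scales [decided toy]. [folklore] -/
def scC (K : ℕ) : IxC Lb K → ℕ
  | Sum.inl _ => 0
  | Sum.inr (Sum.inl _) => min 1 K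
  | Sum.inr (Sum.inr i) => i.val

/-- THE PARENT BLOCK of a sub-block [decided toy]: `parent x i = x i ∕ Lb` (`x i < Lb·Lb`). [folklore] -/
def parent (x : Blk (Lb * Lb)) : Blk Lb := fun i => ⟨(x i : ℕ) / Lb, Nat.div_lt_of_lt_mul (x i).isLt⟩

/-- [folklore] One `Lb`-fold blocking sends a sub-block's coordinates to its parent's (beside W14's `coarsen_coords_zero`∕`_succ`). -/
theorem coarsen_one_coords (x : Blk (Lb * Lb)) : coarsen Lb 1 (coords x) = coords (parent x) := by
  funext i; simp [coarsen, coords, parent]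

/-- BLOCK KEY of a family on `ℕ⁴` [decided toy]: its own coordinates at its birth scale (the head sits at the origin). [folklore] -/
def keyD : IxB Lb → (Fin 4 → ℕ)
  | Sum.inl x => coords x
  | Sum.inr (Sum.inl y) => coords y
  | Sum.inr (Sum.inr _) => 0

/-- THE LAYER of a family [decided toy]: `0` sub-blocks, `1` blocks, `2` the head (its NOMINAL scale, reached at cutoffs `K ≥ 2`). [folklore] -/
def layer : IxB Lb → Fin 3
  | Sum.inl _ => 0
  | Sum.inr (Sum.inl _) => 1
  | Sum.inr (Sum.inr _) => 2

/-- [folklore] Within one layer the block key determines the family. -/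
theorem keyD_inj : ∀ a b : IxB Lb, layer a = layer b → keyD a = keyD b → a = b
  | Sum.inl _, Sum.inl _, _, h => by rw [coords_injective h]
  | Sum.inr (Sum.inl _), Sum.inr (Sum.inl _), _, h => by rw [coords_injective h]
  | Sum.inr (Sum.inr ()), Sum.inr (Sum.inr ()), _, _ => rfl
  | Sum.inl _, Sum.inr (Sum.inl _), h, _ => by simp [layer] at h
  | Sum.inl _, Sum.inr (Sum.inr _), h, _ => by simp [layer] at h
  | Sum.inr (Sum.inl _), Sum.inl _, h, _ => by simp [layer] at h
  | Sum.inr (Sum.inl _), Sum.inr (Sum.inr _), h, _ => by simp [layer] at h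
  | Sum.inr (Sum.inr _), Sum.inl _, h, _ => by simp [layer] at h
  | Sum.inr (Sum.inr _), Sum.inr (Sum.inl _), h, _ => by simp [layer] at h

/-- The sub-block layer inside the birth index. [folklore] -/
def subEmb : Blk (Lb * Lb) ↪ IxB Lb := ⟨Sum.inl, Sum.inl_injective⟩

/-- The block layer inside the birth index. [folklore] -/
def blkEmb : Blk Lb ↪ IxB Lb := ⟨fun y => Sum.inr (Sum.inl y), fun _ _ h => by simpa using h⟩

/-- FELT FAMILIES [decided toy]: a sub-block cube feels its family; a block cube its family and, once `K ≥ 1`, the sub-blocks beneath it; an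
origin cube of scale `i` every family born `≤ i` whose block key coarsens to the origin in `i − j_b` steps. [folklore] -/
def feltD (K : ℕ) : IxC Lb K → Finset (IxB Lb)
  | Sum.inl x => {Sum.inl x}
  | Sum.inr (Sum.inl y) => insert (Sum.inr (Sum.inl y))
      (if 1 ≤ K then ((univ : Finset (Blk (Lb * Lb))).filter fun x => parent x = y).map subEmb else ∅)
  | Sum.inr (Sum.inr i) => univ.filter fun b => scB K b ≤ i.val ∧ coarsen Lb (i.val - scB K b) (keyD b) = 0

/-- [folklore] Membership under a block cube. -/
theorem mem_feltD_block (K : ℕ) (y : Blk Lb) (b : IxB Lb) :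
    b ∈ feltD K (Sum.inr (Sum.inl y) : IxC Lb K) ↔ b = Sum.inr (Sum.inl y) ∨ (1 ≤ K ∧ ∃ x, parent x = y ∧ Sum.inl x = b) := by
  unfold feltD
  rw [mem_insert]
  split_ifs with h
  · simp [h, subEmb]
  · simp [h]

/-- [folklore] Membership at an origin cube. -/
theorem mem_feltD_origin (K : ℕ) (i : Fin (K + 1)) (b : IxB Lb) :
    b ∈ feltD K (Sum.inr (Sum.inr i) : IxC Lb K) ↔ scB K b ≤ i.val ∧ coarsen Lb (i.val - scB K b) (keyD b) = 0 := by
  unfold feltD; rw [mem_filter]; exact ⟨fun h => h.2, fun h => ⟨mem_univ _, h⟩⟩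

/-- [folklore] Felt families are born no later than the cube's scale. -/
theorem feltD_le (K : ℕ) : ∀ q : IxC Lb K, ∀ b ∈ feltD K q, scB K b ≤ scC K q
  | Sum.inl x, b, hb => by
      have hb' : b = Sum.inl x := by simpa [feltD] using hb
      subst hb'; exact le_rfl
  | Sum.inr (Sum.inl y), b, hb => by
      rcases (mem_feltD_block K y b).mp hb with rfl | ⟨_, x, _, rfl⟩
      · exact le_rfl
      · exact Nat.zero_le _
  | Sum.inr (Sum.inr i), b, hb => ((mem_feltD_origin K i b).mp hb).1

/-- THE HEAD's ORIGIN CUBE at its birth scale `min 2 K`. [folklore] -/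
abbrev headCube (K : ℕ) : IxC Lb K := Sum.inr (Sum.inr ⟨min 2 K, Nat.lt_succ_of_le (Nat.min_le_right 2 K)⟩)

/-- THE ABSORBED FAMILIES [decided toy]: the head absorbs EVERY strictly older family felt at its origin cube (from `K ≥ 2` on: both full
layers — PART 2); nobody else absorbs. [folklore] -/
def absD (K : ℕ) : IxB Lb → Finset (IxB Lb)
  | Sum.inr (Sum.inr _) => (feltD K (headCube K)).filter fun b => scB K b < min 2 K
  | _ => ∅

/-- [folklore] Only the head absorbs. -/
theorem absD_of_ne (K : ℕ) : ∀ b : IxB Lb, b ≠ headD Lb → absD K b = ∅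
  | Sum.inl _, _ => rfl
  | Sum.inr (Sum.inl _), _ => rfl
  | Sum.inr (Sum.inr ()), h => (h rfl).elim

/-- [folklore] Absorbed families are strictly older (and so never the head itself). -/
theorem absD_lt (K : ℕ) : ∀ b' b : IxB Lb, b ∈ absD K b' → scB K b < scB K b' := by
  intro b' b hb
  by_cases h : b' = headD Lb
  · subst h; exact (mem_filter.mp hb).2
  · rw [absD_of_ne K b' h] at hb; simp at hb

/-- THE ABSORBED MASS of the head [decided toy]: `AD⁻¹ ×` what the head pays — every absorbed family's dressing `τ^(K−j₀)` transported
`min 2 K − j₀` steps (BOTH layers summed, BY DEFINITION). [folklore] -/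
def massD (Lb K : ℕ) : ℝ := ∑ b₀ ∈ absD K (headD Lb), tW ^ (K - scB K b₀) * rW ^ (min 2 K - scB K b₀)

/-- [folklore] The absorbed mass is nonnegative. -/
theorem massD_nonneg (Lb K : ℕ) : 0 ≤ massD Lb K :=
  sum_nonneg fun _ _ => mul_nonneg (pow_nonneg tW_pos.le _) (pow_nonneg rW_pos.le _)

/-- THE ABSORPTION WEIGHT [decided toy]: `AD = 1∕504` (fan-out `AD·(vR·mB)·(1−ρ′)⁻¹ = (1∕504)·3·42 = 1∕4`). [folklore] -/
abbrev AD : ℝ := 1 / 504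

/-- BIRTH GENERATIONS [decided toy]: the dressing `τ^(K−j_b)`, plus `AD·massD` for the head. [folklore] -/
def gD (K : ℕ) : IxB Lb → ℝ
  | Sum.inr (Sum.inr _) => tW ^ (K - min 2 K) + AD * massD Lb K
  | b => tW ^ (K - scB K b)

/-- [folklore] A non-head family's generation is its dressing. -/
theorem gD_of_ne (K : ℕ) : ∀ b : IxB Lb, b ≠ headD Lb → gD K b = tW ^ (K - scB K b)
  | Sum.inl _, _ => rfl
  | Sum.inr (Sum.inl _), _ => rfl
  | Sum.inr (Sum.inr ()), h => (h rfl).elim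

/-- [folklore] Birth generations are positive. -/
theorem gD_pos (K : ℕ) : ∀ b : IxB Lb, 0 < gD K b
  | Sum.inl _ => pow_pos tW_pos _
  | Sum.inr (Sum.inl _) => pow_pos tW_pos _
  | Sum.inr (Sum.inr _) => by
      have := massD_nonneg Lb K; have := pow_pos tW_pos (K - min 2 K)
      show 0 < tW ^ (K - min 2 K) + AD * massD Lb K; positivity

/-- BOOKED SIZE [decided toy]: generation × `ρ^(k − j_b)`. [folklore] -/
def sizeD (K : ℕ) (b : IxB Lb) (k : ℕ) : ℝ := gD K b * rW ^ (k - scB K b)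

/-- [folklore] Booked sizes are positive. -/
theorem sizeD_pos (K : ℕ) (b : IxB Lb) (k : ℕ) : 0 < sizeD K b k := mul_pos (gD_pos K b) (pow_pos rW_pos _)

/-- [folklore] Convention (A) for the toy trajectory: the size is the one live generation. -/
theorem size_le_aux (K : ℕ) (b : IxB Lb) (k : ℕ) (hbk : scB K b ≤ k) :
    sizeD K b k ≤ ∑ k' ∈ Icc (scB K b) k, (if k' = scB K b then sizeD K b k else 0) := by
  rw [sum_ite_eq', if_pos (mem_Icc.mpr ⟨le_rfl, hbk⟩)]

variable (Lb)

/-- TOY BOOKING at cutoff `K` [decided toy].  Nothing of Bałaban's is modelled. [folklore] -/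
def BkD (K : ℕ) : T4TermFormat.Booking where
  K := K
  Dom := IxB Lb
  domScale := scB K
  treeLen := fun _ => 0
  treeLen_nonneg := fun _ => le_rfl
  balSize := fun _ => 0
  Birth := IxB Lb
  births := univ
  mem_births := mem_univ
  birthScale := scB K
  birth_le := scB_le K
  loc := id
  loc_scale := fun _ => rfl
  Cube := IxC Lb K
  cubes := univ
  mem_cubes := mem_univ
  cubeScale := scC K
  cube_le := fun q => by
    rcases q with _ | _ | i
    · exact Nat.zero_le K
    · exact Nat.min_le_right 1 K
    · exact Nat.lt_succ_iff.mp i.isLt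
  feltAt := feltD K
  felt_birth_le := feltD_le K
  size := sizeD K
  size_nonneg := fun b k => (sizeD_pos K b k).le
  pair := fun _ _ _ => 0

/-- TOY TRAJECTORY [decided toy]: one generation per family (its birth), transported at the cell's rate. [folklore] -/
def TrD (K : ℕ) : Trajectory (BkD Lb K) where
  lin := fun b k' k => if k' = scB K b then sizeD K b k else 0
  lin_nonneg := fun b k' k => by have := sizeD_pos K b k; split_ifs <;> positivity
  gen := fun b k' => if k' = scB K b then gD K b else 0
  gen_nonneg := fun b k' => by have := gD_pos K b; split_ifs <;> positivity
  size_le := fun b k hbk _ => size_le_aux K b k hbk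

/-- THE TOWER [decided toy]: one run parameter, every cutoff. [folklore] -/
def towerD : DressedTower Unit where
  B := fun _ K => BkD Lb K
  K_eq := fun _ _ => rfl
  T := fun _ K => TrD Lb K

/-- BLOCK CENTRE of a cube on `ℕ⁴` [decided toy]. [folklore] -/
def centerD (K : ℕ) : IxC Lb K → (Fin 4 → ℕ)
  | Sum.inl x => coords x
  | Sum.inr (Sum.inl y) => coords y
  | Sum.inr (Sum.inr _) => 0

/-- [folklore] FELT ⇒ UNDER, on the raw index types: some domain block of a felt family coarsens (in `cube scale − birth scale` steps) to
the cube's block — by `coarsen_coords_zero` (own cube), `coarsen_one_coords` (a block cube over its sub-blocks), the origin cubes' condition. -/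
theorem felt_under_aux (K : ℕ) : ∀ (q : IxC Lb K) (b : IxB Lb), b ∈ feltD K q →
    ∃ x ∈ ({keyD b} : Finset (Fin 4 → ℕ)), coarsen Lb (scC K q - scB K b) x = centerD Lb K q
  | Sum.inl x, b, hb => by
      have hb' : b = Sum.inl x := by simpa [feltD] using hb
      subst hb'
      exact ⟨coords x, mem_singleton_self _, coarsen_coords_zero x⟩
  | Sum.inr (Sum.inl y), b, hb => by
      rcases (mem_feltD_block K y b).mp hb with rfl | ⟨hK, x', hx', rfl⟩
      · exact ⟨coords y, mem_singleton_self _, by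
          show coarsen Lb (min 1 K - min 1 K) (coords y) = coords y
          rw [Nat.sub_self]; exact coarsen_coords_zero y⟩
      · refine ⟨coords x', mem_singleton_self _, ?_⟩
        show coarsen Lb (min 1 K - 0) (coords x') = coords y
        rw [Nat.min_eq_left hK, Nat.sub_zero, ← hx']
        exact coarsen_one_coords x'
  | Sum.inr (Sum.inr i), b, hb => ⟨keyD b, mem_singleton_self _, ((mem_feltD_origin K i b).mp hb).2⟩

/-- THE ANCHORING ON `ℕ⁴` WITH BLOCKING INTEGER `Lb` [decided toy]: every family localised at its own block; `felt_under` by the GENUINE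
coarsening `coarsen Lb 1 (coords x) = coords (parent x)` (a block cube over its sub-blocks) and by the origin cubes' own condition. [folklore] -/
def AncD (K : ℕ) : Anchoring (BkD Lb K) 4 Lb where
  dom := fun b => {keyD b}
  center := centerD Lb K
  felt_under := fun q b hb => felt_under_aux Lb K q b hb

variable {Lb} in
/-- [folklore] One family per layer per block: the births of a fixed layer holding a fixed block number at most one. -/
theorem card_layer_key_le_one (l : Fin 3) (x : Fin 4 → ℕ) :
    ((univ : Finset (IxB Lb)).filter fun b => layer b = l ∧ x ∈ ({keyD b} : Finset (Fin 4 → ℕ))).card ≤ 1 := by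
  refine card_le_one.mpr fun a ha b hb => ?_
  have ha' := (mem_filter.mp ha).2
  have hb' := (mem_filter.mp hb).2
  rw [mem_singleton] at ha' hb'
  exact keyD_inj a b (ha'.1.trans hb'.1.symm) (ha'.2.symm.trans hb'.2)

variable {Lb} in
/-- [folklore] At most THREE families of a given scale hold a given block — at most one per layer, whatever the scale bookkeeping. -/
theorem card_scale_key_le_three (K j : ℕ) (x : Fin 4 → ℕ) :
    ((univ : Finset (IxB Lb)).filter fun b => scB K b = j ∧ x ∈ ({keyD b} : Finset (Fin 4 → ℕ))).card ≤ 3 := by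
  have hsub : ((univ : Finset (IxB Lb)).filter fun b => scB K b = j ∧ x ∈ ({keyD b} : Finset (Fin 4 → ℕ))) ⊆
      (univ : Finset (Fin 3)).biUnion fun l =>
        (univ : Finset (IxB Lb)).filter fun b => layer b = l ∧ x ∈ ({keyD b} : Finset (Fin 4 → ℕ)) := by
    intro b hb
    exact mem_biUnion.mpr ⟨layer b, mem_univ _, mem_filter.mpr ⟨mem_univ _, rfl, (mem_filter.mp hb).2.2⟩⟩
  calc ((univ : Finset (IxB Lb)).filter fun b => scB K b = j ∧ x ∈ ({keyD b} : Finset (Fin 4 → ℕ))).card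
      ≤ ((univ : Finset (Fin 3)).biUnion fun l =>
          (univ : Finset (IxB Lb)).filter fun b => layer b = l ∧ x ∈ ({keyD b} : Finset (Fin 4 → ℕ))).card := card_le_card hsub
    _ ≤ ∑ l : Fin 3, ((univ : Finset (IxB Lb)).filter fun b => layer b = l ∧ x ∈ ({keyD b} : Finset (Fin 4 → ℕ))).card :=
        card_biUnion_le
    _ ≤ ∑ _l : Fin 3, 1 := sum_le_sum fun l _ => card_layer_key_le_one l x
    _ = 3 := by simp

/-- **MULTIPLICITY `mB = 3`, UNIFORMLY IN THE CUTOFF** [decided toy]: a block of a given scale lies in the domains of at most THREE families of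
that scale — at most one per layer (`keyD_inj`); at the degenerate cutoffs `K ≤ 1` layers share a scale, from `K ≥ 2` on the sharp
multiplicity is `1` (PART 2). [folklore] -/
theorem hmultD (K : ℕ) : ∀ j (x : Fin 4 → ℕ),
    ((BkD Lb K).births.filter fun b => (BkD Lb K).birthScale b = j ∧ x ∈ (AncD Lb K).dom b).card ≤ 3 := by
  intro j x
  show ((univ : Finset (IxB Lb)).filter fun b => scB K b = j ∧ x ∈ ({keyD b} : Finset (Fin 4 → ℕ))).card ≤ 3
  exact card_scale_key_le_three K j x

/-- THE CUBE OF A FAMILY at its birth scale [decided toy] (the head: its origin cube). [folklore] -/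
def cubeOf (K : ℕ) : IxB Lb → IxC Lb K
  | Sum.inl x => Sum.inl x
  | Sum.inr (Sum.inl y) => Sum.inr (Sum.inl y)
  | Sum.inr (Sum.inr _) => headCube K

/-- [folklore] The family's cube has the family's birth scale. -/
theorem scC_cubeOf (K : ℕ) : ∀ b : IxB Lb, scC K (cubeOf Lb K b) = scB K b
  | Sum.inl _ => rfl
  | Sum.inr (Sum.inl _) => rfl
  | Sum.inr (Sum.inr _) => rfl

/-- [folklore] The one cube of a family's component has the family's scale (raw index types). -/
theorem comp_scale_aux (K : ℕ) (b : IxB Lb) (q : IxC Lb K) (hq : q ∈ ({cubeOf Lb K b} : Finset (IxC Lb K))) :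
    scC K q = scB K b := by
  rw [mem_singleton] at hq; subst hq; exact scC_cubeOf Lb K b

/-- [folklore] An absorbed family is felt at the absorber's cube (only the head absorbs, and its absorbed set is cut out of what its origin
cube feels). -/
theorem absorbs_felt_aux (K : ℕ) (b' b : IxB Lb) (hb : b ∈ absD K b') :
    ∃ q ∈ ({cubeOf Lb K b'} : Finset (IxC Lb K)), b ∈ feltD K q := by
  refine ⟨cubeOf Lb K b', mem_singleton_self _, ?_⟩
  by_cases h : b' = headD Lb
  · subst h; exact (mem_filter.mp hb).1
  · rw [absD_of_ne K b' h] at hb; simp at hb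

/-- THE ℝ-STEP DATUM [decided toy]: pre-ℝ sizes = the transported sizes, the head absorbs both layers, the renormalised component of a
family is its own cube (an absorbed family IS felt at the head's origin cube — by the absorbed set's definition), dressings `τ^(K−j)`.
[folklore] -/
def RsD (K : ℕ) : RStep (BkD Lb K) where
  pre := sizeD K
  pre_nonneg := fun b k => (sizeD_pos K b k).le
  absorbs := absD K
  absorbs_lt := absD_lt K
  comp := fun b => {cubeOf Lb K b}
  comp_scale := fun b q hq => comp_scale_aux Lb K b q hq
  absorbs_felt := fun b' b hb => absorbs_felt_aux Lb K b' b hb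
  δ := fun b => tW ^ (K - scB K b)
  δ_nonneg := fun _ => pow_nonneg tW_pos.le _

/-- Component volume of the ℝ-step: `vR = 1`. [folklore] -/
theorem compVolD (K : ℕ) : (RsD Lb K).CompVol 1 := fun b => by
  show ({cubeOf Lb K b} : Finset (IxC Lb K)).card ≤ 1; rw [card_singleton]

end Toy

end Summit.QuantumFields.BalabanUV.T4Continuum.NE1p.DressedSuppliedDepthTwoWitness

end
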